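import Summits.ResolutionOfSingularities.ResolutionOfSingularities.Theorems.FrobeniusClosingPatchingRelPerfectConeDepthSmoothQuadricDisc
import Summits.ResolutionOfSingularities.ResolutionOfSingularities.Theorems.FrobeniusClosingPatchingRelPerfectConeDepthLineCharts
import HarnessLib

/-!
# Crux `PatchingRelPerfect` (stmt-ResolutionOfSingularities-16161), chain W5.2 — rung «r-binary-disc-ℓ», local algebra of the FOOT:
# the binary form `T₀² + b T₀T₁ + a T₁²` (`b² − 4a` a unit) on the four charts of the blowing up of a closed POINT

[OURS · L1 W5.2 · rung tool] Replaces the role of NO printed item; NOT a statement of the manuscript under review; fact-free,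
any characteristic, any residue field.  AI-written (AI review is weaker than expert review).

`R` regular local of dimension four with regular system of parameters `c`, `Q = T₀² + b T₀T₁ + a T₁² ∈ R[T₀, …, T₃]` with
`b² − 4a ∈ R×`; on the chart `B_i` of `Bl_𝔪 Spec R` the host is `f_i = e₀² + b e₀e₁ + a e₁²` (`e_i = 1`).  PROVED:
* charts `0, 1` (`f₀ = 1 + b e₁ + a e₁²`, `f₁ = e₀² + b e₀ + a`): the reduced chart polynomial is SMOOTH — certificates
  `(F_i, ∂F_i) = (1)` from `(b + 2a T)² − 4a(1 + bT + aT²) = b² − 4a = (2T + b)² − 4(T² + bT + a)` (`binForm_smooth_zero/one`),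
  so the tree's `smoothQuadChart` applies at every prime over `𝔪`;
* charts `2, 3` OFF the new line (`¬ (e₀ ∈ 𝔓 ∧ e₁ ∈ 𝔓)`): one of `∂F/∂T₀ = 2T₀ + bT₁`, `∂F/∂T₁ = bT₀ + 2aT₁` has a lift outside
  `𝔓` (`binary_partial_notMem`), and the Jacobian criterion `isRsopPart_kill_hypersurface` makes the members of `{φ c_i, f_i}` in
  `𝔓` part of one regular system of parameters (`pointChart_far`);
* charts `2, 3` ON the new line (`e₀, e₁ ∈ 𝔓`, any prime — closed point or generic point of the line): `(φ c_i, e₀, e₁)` is part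
  of a regular system of parameters of the local ring (`pointLine`, the tree's `isRsopPart_chartFamily_cone`).

## References
* H. Matsumura, *Commutative Ring Theory*, Thm. 14.2, Thm. 30.3. [Matsumura1987]
* The Stacks Project, Tag 0BIQ. [StacksProject]
-/

set_option linter.dupNamespace false

noncomputable section

open CategoryTheory CategoryTheory.Limits AlgebraicGeometry TopologicalSpace IsLocalRing
open Literature.AlgebraicGeometry.Resolution
open Scheme.IdealSheafData
open scoped Pointwise

namespace Summit.ResolutionOfSingularities.ResolutionOfSingularities.Theorems

universe u

namespace ConeDepth

/-! ## §1 The binary form as a quaternary form, and its reduced chart polynomials -/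

section BinForm

variable {S : Type u} [CommRing S] (a b : S)

/-- `T₀² + b T₀T₁ + a T₁²` is a form of degree `2`. [folklore] -/
theorem isHomogeneous_binForm :
    (MvPolynomial.X 0 * MvPolynomial.X 0 + MvPolynomial.C b * (MvPolynomial.X 0 * MvPolynomial.X 1) +
      MvPolynomial.C a * (MvPolynomial.X 1 * MvPolynomial.X 1) : MvPolynomial (Fin 4) S).IsHomogeneous 2 := by
  have hX : ∀ j : Fin 4, (MvPolynomial.X j : MvPolynomial (Fin 4) S).IsHomogeneous 1 := fun j =>
    MvPolynomial.isHomogeneous_X S j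
  have hC : ∀ s : S, (MvPolynomial.C s : MvPolynomial (Fin 4) S).IsHomogeneous 0 := fun s =>
    MvPolynomial.isHomogeneous_C _ s
  have h1 : (MvPolynomial.X 0 * MvPolynomial.X 0 : MvPolynomial (Fin 4) S).IsHomogeneous 2 := (hX 0).mul (hX 0)
  have h2 : (MvPolynomial.C b * (MvPolynomial.X 0 * MvPolynomial.X 1) : MvPolynomial (Fin 4) S).IsHomogeneous 2 := by
    simpa using (hC b).mul ((hX 0).mul (hX 1))
  have h3 : (MvPolynomial.C a * (MvPolynomial.X 1 * MvPolynomial.X 1) : MvPolynomial (Fin 4) S).IsHomogeneous 2 := by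
    simpa using (hC a).mul ((hX 1).mul (hX 1))
  exact (h1.add h2).add h3

/-- `Q(x) = x₀x₀ + b (x₀x₁) + a (x₁x₁)`. [folklore] -/
theorem eval_binForm (x : Fin 4 → S) :
    MvPolynomial.eval x (MvPolynomial.X 0 * MvPolynomial.X 0 + MvPolynomial.C b * (MvPolynomial.X 0 * MvPolynomial.X 1) +
      MvPolynomial.C a * (MvPolynomial.X 1 * MvPolynomial.X 1)) = x 0 * x 0 + b * (x 0 * x 1) + a * (x 1 * x 1) := by
  simp only [map_add, map_mul, MvPolynomial.eval_X, MvPolynomial.eval_C]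

/-- **The host on the chart**: `f_i = e₀e₀ + b (e₀e₁) + a (e₁e₁)`. [folklore] -/
theorem chartForm_binForm (c : Fin 4 → S) (i : Fin 4) :
    chartForm (MvPolynomial.X 0 * MvPolynomial.X 0 + MvPolynomial.C b * (MvPolynomial.X 0 * MvPolynomial.X 1) +
      MvPolynomial.C a * (MvPolynomial.X 1 * MvPolynomial.X 1)) c i =
      chartGen c i 0 * chartGen c i 0 + chartBase c i b * (chartGen c i 0 * chartGen c i 1) +
        chartBase c i a * (chartGen c i 1 * chartGen c i 1) := by
  simp only [chartForm, MvPolynomial.coe_eval₂Hom, MvPolynomial.eval₂_add, MvPolynomial.eval₂_mul, MvPolynomial.eval₂_X,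
    MvPolynomial.eval₂_C]

/-- **Unit discriminant off the line** (any prime `𝔔` of any ring; numeral-free, the discriminant written `bb − (a+a+a+a)`):
if not both `u, v ∈ 𝔔` then `2u + b v ∉ 𝔔` or `b u + 2a v ∉ 𝔔` (`b(bu + 2av) − 2a(2u + bv) = (b² − 4a)u`,
`b(2u + bv) − 2(bu + 2av) = (b² − 4a)v`). [folklore] -/
theorem binary_partial_notMem {B : Type u} [CommRing B] (𝔔 : Ideal B) [𝔔.IsPrime] (a' b' u v : B)
    (hD : IsUnit (b' * b' - (a' + a' + (a' + a')))) (hnl : ¬ (u ∈ 𝔔 ∧ v ∈ 𝔔)) :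
    (u + u + b' * v) ∉ 𝔔 ∨ (b' * u + (a' * v + a' * v)) ∉ 𝔔 := by
  by_contra h
  simp only [not_or, not_not] at h
  obtain ⟨h1, h2⟩ := h
  have hDn : b' * b' - (a' + a' + (a' + a')) ∉ 𝔔 := fun hu =>
    Ideal.IsPrime.ne_top inferInstance (Ideal.eq_top_of_isUnit_mem _ hu hD)
  apply hnl
  constructor
  · have hmem : (b' * b' - (a' + a' + (a' + a'))) * u ∈ 𝔔 := by
      have : (b' * b' - (a' + a' + (a' + a'))) * u = b' * (b' * u + (a' * v + a' * v)) - (a' + a') * (u + u + b' * v) := by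
        ring
      rw [this]
      exact 𝔔.sub_mem (𝔔.mul_mem_left _ h2) (𝔔.mul_mem_left _ h1)
    exact (Ideal.IsPrime.mem_or_mem inferInstance hmem).resolve_left hDn
  · have hmem : (b' * b' - (a' + a' + (a' + a'))) * v ∈ 𝔔 := by
      have : (b' * b' - (a' + a' + (a' + a'))) * v =
          b' * (u + u + b' * v) - ((b' * u + (a' * v + a' * v)) + (b' * u + (a' * v + a' * v))) := by ring
      rw [this]
      exact 𝔔.sub_mem (𝔔.mul_mem_left _ h1) (𝔔.add_mem h2 h2)
    exact (Ideal.IsPrime.mem_or_mem inferInstance hmem).resolve_left hDn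

variable [IsLocalRing S]

/-- The reduced chart polynomials of `T₀² + b T₀T₁ + a T₁²` in terms of `killVar`. [folklore] -/
theorem chartPoly_binForm (i : Fin 4) :
    chartPoly (MvPolynomial.X 0 * MvPolynomial.X 0 + MvPolynomial.C b * (MvPolynomial.X 0 * MvPolynomial.X 1) +
      MvPolynomial.C a * (MvPolynomial.X 1 * MvPolynomial.X 1)) i =
      killVar i 0 * killVar i 0 + MvPolynomial.C (residue S b) * (killVar i 0 * killVar i 1) +
        MvPolynomial.C (residue S a) * (killVar i 1 * killVar i 1) := by
  simp only [chartPoly, map_add, map_mul, MvPolynomial.map_X, MvPolynomial.map_C, MvPolynomial.aeval_X,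
    MvPolynomial.algHom_C, MvPolynomial.algebraMap_eq]

/-- Chart `T₀ = 1`: `F₀ = 1 + b̄T₁ + āT₁²`, `(∂₁F₀)² − 4ā F₀ = b̄² − 4ā`, a unit. [cite: Matsumura1987, Thm. 30.3] -/
theorem binForm_smooth_zero (hD : IsUnit (b ^ 2 - 4 * a)) :
    Ideal.span (insert (chartPoly (MvPolynomial.X 0 * MvPolynomial.X 0 +
        MvPolynomial.C b * (MvPolynomial.X 0 * MvPolynomial.X 1) + MvPolynomial.C a * (MvPolynomial.X 1 * MvPolynomial.X 1)) 0)
      (Set.range fun t => MvPolynomial.pderiv t (chartPoly (MvPolynomial.X 0 * MvPolynomial.X 0 +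
        MvPolynomial.C b * (MvPolynomial.X 0 * MvPolynomial.X 1) +
        MvPolynomial.C a * (MvPolynomial.X 1 * MvPolynomial.X 1)) 0))) = ⊤ := by
  classical
  have hd : residue S b ^ 2 - 4 * residue S a ≠ 0 := by
    have h := (hD.map (residue S)).ne_zero
    rwa [map_sub, map_pow, map_mul, map_ofNat] at h
  set F := chartPoly (MvPolynomial.X 0 * MvPolynomial.X 0 + MvPolynomial.C b * (MvPolynomial.X 0 * MvPolynomial.X 1) +
        MvPolynomial.C a * (MvPolynomial.X 1 * MvPolynomial.X 1)) 0 with hFdef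
  set I := Ideal.span (insert F (Set.range fun t => MvPolynomial.pderiv t F)) with hI
  have hF : F ∈ I := Ideal.subset_span (Set.mem_insert _ _)
  have hdF : ∀ t, MvPolynomial.pderiv t F ∈ I := fun t =>
    Ideal.subset_span (Set.mem_insert_of_mem _ (Set.mem_range_self t))
  have hFexp : F = 1 + MvPolynomial.C (residue S b) * MvPolynomial.X ⟨1, by decide⟩ +
      MvPolynomial.C (residue S a) * (MvPolynomial.X ⟨1, by decide⟩ * MvPolynomial.X ⟨1, by decide⟩) := by
    rw [hFdef, chartPoly_binForm, killVar_self, killVar_of_ne 0 1 (by decide)]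
    ring
  have h1 : MvPolynomial.pderiv (⟨1, by decide⟩ : {j : Fin 4 // j ≠ 0}) F =
      MvPolynomial.C (residue S b) + 2 * MvPolynomial.C (residue S a) * MvPolynomial.X ⟨1, by decide⟩ := by
    rw [hFexp]
    simp [MvPolynomial.pderiv_X]
    ring
  have hmem : MvPolynomial.pderiv (⟨1, by decide⟩ : {j : Fin 4 // j ≠ 0}) F * MvPolynomial.pderiv ⟨1, by decide⟩ F -
      4 * MvPolynomial.C (residue S a) * F ∈ I :=
    I.sub_mem (I.mul_mem_left _ (hdF _)) (I.mul_mem_left _ hF)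
  refine ideal_eq_top_of_mem_of_eq_C hmem ?_ hd
  rw [h1, hFexp, map_sub, map_pow, map_mul, map_ofNat]
  ring

/-- Chart `T₁ = 1`: `F₁ = T₀² + b̄T₀ + ā`, `(∂₀F₁)² − 4F₁ = b̄² − 4ā`, a unit. [cite: Matsumura1987, Thm. 30.3] -/
theorem binForm_smooth_one (hD : IsUnit (b ^ 2 - 4 * a)) :
    Ideal.span (insert (chartPoly (MvPolynomial.X 0 * MvPolynomial.X 0 +
        MvPolynomial.C b * (MvPolynomial.X 0 * MvPolynomial.X 1) + MvPolynomial.C a * (MvPolynomial.X 1 * MvPolynomial.X 1)) 1)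
      (Set.range fun t => MvPolynomial.pderiv t (chartPoly (MvPolynomial.X 0 * MvPolynomial.X 0 +
        MvPolynomial.C b * (MvPolynomial.X 0 * MvPolynomial.X 1) +
        MvPolynomial.C a * (MvPolynomial.X 1 * MvPolynomial.X 1)) 1))) = ⊤ := by
  classical
  have hd : residue S b ^ 2 - 4 * residue S a ≠ 0 := by
    have h := (hD.map (residue S)).ne_zero
    rwa [map_sub, map_pow, map_mul, map_ofNat] at h
  set F := chartPoly (MvPolynomial.X 0 * MvPolynomial.X 0 + MvPolynomial.C b * (MvPolynomial.X 0 * MvPolynomial.X 1) +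
        MvPolynomial.C a * (MvPolynomial.X 1 * MvPolynomial.X 1)) 1 with hFdef
  set I := Ideal.span (insert F (Set.range fun t => MvPolynomial.pderiv t F)) with hI
  have hF : F ∈ I := Ideal.subset_span (Set.mem_insert _ _)
  have hdF : ∀ t, MvPolynomial.pderiv t F ∈ I := fun t =>
    Ideal.subset_span (Set.mem_insert_of_mem _ (Set.mem_range_self t))
  have hFexp : F = MvPolynomial.X ⟨0, by decide⟩ * MvPolynomial.X ⟨0, by decide⟩ +
      MvPolynomial.C (residue S b) * MvPolynomial.X ⟨0, by decide⟩ + MvPolynomial.C (residue S a) := by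
    rw [hFdef, chartPoly_binForm, killVar_self, killVar_of_ne 1 0 (by decide)]
    ring
  have h0 : MvPolynomial.pderiv (⟨0, by decide⟩ : {j : Fin 4 // j ≠ 1}) F =
      2 * MvPolynomial.X ⟨0, by decide⟩ + MvPolynomial.C (residue S b) := by
    rw [hFexp]
    simp [MvPolynomial.pderiv_X]
    ring
  have hmem : MvPolynomial.pderiv (⟨0, by decide⟩ : {j : Fin 4 // j ≠ 1}) F * MvPolynomial.pderiv ⟨0, by decide⟩ F - 4 * F ∈ I :=
    I.sub_mem (I.mul_mem_left _ (hdF _)) (I.mul_mem_left _ hF)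
  refine ideal_eq_top_of_mem_of_eq_C hmem ?_ hd
  rw [h0, hFexp, map_sub, map_pow, map_mul, map_ofNat]
  ring

/-- The reduced chart polynomials of `T₀² + b T₀T₁ + a T₁²` are non-zero (charts `≠ 1`: value `1` at `T₀ = 1, T_j = 0`; chart
`1`: smoothness). [folklore] -/
theorem chartPoly_binForm_ne_zero (hD : IsUnit (b ^ 2 - 4 * a)) (i : Fin 4) :
    chartPoly (MvPolynomial.X 0 * MvPolynomial.X 0 + MvPolynomial.C b * (MvPolynomial.X 0 * MvPolynomial.X 1) +
      MvPolynomial.C a * (MvPolynomial.X 1 * MvPolynomial.X 1)) i ≠ 0 := by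
  classical
  by_cases hi : i = 1
  · subst hi
    exact chartPoly_ne_zero_of_smooth _ 1 (binForm_smooth_one a b hD)
  · intro h
    have hk0 : MvPolynomial.eval (fun j : {j : Fin 4 // j ≠ i} => if j.1 = 0 then (1 : ResidueField S) else 0)
        (killVar i 0) = 1 := by
      by_cases h0 : (0 : Fin 4) = i
      · subst h0; rw [killVar_self, map_one]
      · rw [killVar_of_ne i 0 h0, MvPolynomial.eval_X, if_pos rfl]
    have hk1 : MvPolynomial.eval (fun j : {j : Fin 4 // j ≠ i} => if j.1 = 0 then (1 : ResidueField S) else 0)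
        (killVar i 1) = 0 := by
      rw [killVar_of_ne i 1 (Ne.symm hi), MvPolynomial.eval_X]
      simp
    have h' := congrArg (MvPolynomial.eval (fun j : {j : Fin 4 // j ≠ i} => if j.1 = 0 then (1 : ResidueField S) else 0)) h
    rw [chartPoly_binForm, map_add, map_add, map_mul, map_mul, map_mul, map_mul, map_mul, hk0, hk1, MvPolynomial.eval_C,
      MvPolynomial.eval_C, map_zero] at h'
    simp only [mul_one, mul_zero, add_zero] at h'
    exact one_ne_zero h'

end BinForm

/-! ## §2 The charts of the blowing up of the point -/

section PointChart

variable {R : Type u} [CommRing R] [IsRegularLocalRing R] (c : Fin 4 → R)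
  (hz : Ideal.span (Set.range c) = maximalIdeal R) (hd : (maximalIdeal R).spanFinrank = 4) (a b : R) (i : Fin 4)
  (𝔓 : Ideal (chartRing c i)) [𝔓.IsPrime] (h𝔓 : 𝔓.comap (chartBase c i) = maximalIdeal R)
  (L : Type u) [CommRing L] [IsLocalRing L] [Algebra (chartRing c i) L] [IsLocalization.AtPrime L 𝔓]

local notation3 "fpt" => chartGen c i 0 * chartGen c i 0 + chartBase c i b * (chartGen c i 0 * chartGen c i 1) +
  chartBase c i a * (chartGen c i 1 * chartGen c i 1)

include hz hd h𝔓 in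
/-- **The point chart with killed generators and one hypersurface** (the tree's `isRsopPart_kill_hypersurface` on `B_i`): for a
duplicate-free list `l` of indices `j ≠ i` with `e_j ∈ 𝔓` and `f ∈ 𝔓` with a non-zero representative `F ∈ κ[T_j : j ∉ l]` having a
partial derivative with a lift outside `𝔓`, `(φ c_i, e_l, f)` is part of a regular system of parameters of `L`.
[cite: Matsumura1987, Thm. 14.2] -/
theorem isRsopPart_pointKill (l : List {j : Fin 4 // j ≠ i}) (hl : l.Nodup) (hlu : ∀ j ∈ l, chartGen c i j.1 ∈ 𝔓)
    (f : chartRing c i) (hf : f ∈ 𝔓)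
    (F : MvPolynomial {j : {j : Fin 4 // j ≠ i} // j ∉ {j : {j : Fin 4 // j ≠ i} | j ∈ l}} (ResidueField R)) (hF0 : F ≠ 0)
    (hfF : coneε c hz hd i (MvPolynomial.rename Subtype.val F) = Ideal.Quotient.mk _ f)
    (jv : {j : {j : Fin 4 // j ≠ i} // j ∉ {j : {j : Fin 4 // j ≠ i} | j ∈ l}}) (g : chartRing c i)
    (hGa : coneε c hz hd i (MvPolynomial.rename Subtype.val (MvPolynomial.pderiv jv F)) = Ideal.Quotient.mk _ g)
    (hg : g ∉ 𝔓) :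
    IsRsopPart (consFamily c i L (chartBase c i) (killFamily i (chartGen c i) l f)) := by
  haveI : IsNoetherianRing (chartRing c i) := isNoetherianRing_blowupChart c i
  exact isRsopPart_kill_hypersurface c i hz L (chartBase c i) (chartGen c i)
    (reesChartBase_mem_nonZeroDivisors (c i) (Ideal.mem_span_range_self (f := c) (x := i)))
    (coneε c hz hd i) (coneε_X c hz hd i) 𝔓 h𝔓 l hl hlu f hf F hF0 hfF jv g hGa hg

include hz hd in
omit [𝔓.IsPrime] in
/-- **Polynomial representative of the far host** `f_i = e₀e₀ + b (e₀e₁) + a (e₁e₁)` (`i ∉ {0, 1}`): `F = T₀T₀ + b̄ T₀T₁ + ā T₁T₁ ≠ 0`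
over the residue field, with the lifts `2e₀ + b e₁`, `b e₀ + 2a e₁` of its two partial derivatives. [folklore] -/
theorem pointFar_repr (hi0 : (0 : Fin 4) ≠ i) (hi1 : (1 : Fin 4) ≠ i) :
    ∃ F : MvPolynomial {j : {j : Fin 4 // j ≠ i} // j ∉ {j : {j : Fin 4 // j ≠ i} | j ∈ ([] : List {j : Fin 4 // j ≠ i})}}
        (ResidueField R),
      F ≠ 0 ∧ coneε c hz hd i (MvPolynomial.rename Subtype.val F) = Ideal.Quotient.mk _ fpt ∧
      coneε c hz hd i (MvPolynomial.rename Subtype.val (MvPolynomial.pderiv ⟨⟨0, hi0⟩, by simp⟩ F)) =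
        Ideal.Quotient.mk _ (chartGen c i 0 + chartGen c i 0 + chartBase c i b * chartGen c i 1) ∧
      coneε c hz hd i (MvPolynomial.rename Subtype.val (MvPolynomial.pderiv ⟨⟨1, hi1⟩, by simp⟩ F)) =
        Ideal.Quotient.mk _ (chartBase c i b * chartGen c i 0 + (chartBase c i a * chartGen c i 1 + chartBase c i a * chartGen c i 1)) := by
  classical
  let σ := {j : {j : Fin 4 // j ≠ i} // j ∉ {j : {j : Fin 4 // j ≠ i} | j ∈ ([] : List {j : Fin 4 // j ≠ i})}}
  let t0 : σ := ⟨⟨0, hi0⟩, by simp⟩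
  let t1 : σ := ⟨⟨1, hi1⟩, by simp⟩
  have h01 : t0 ≠ t1 := by
    intro h
    have h' : (0 : Fin 4) = 1 := congrArg (fun t : σ => t.1.1) h
    exact absurd h' (by decide)
  let F : MvPolynomial σ (ResidueField R) :=
    MvPolynomial.X t0 * MvPolynomial.X t0 + MvPolynomial.C (residue R b) * (MvPolynomial.X t0 * MvPolynomial.X t1) +
      MvPolynomial.C (residue R a) * (MvPolynomial.X t1 * MvPolynomial.X t1)
  refine ⟨F, ?_, ?_, ?_, ?_⟩
  · intro h
    have h' := congrArg (MvPolynomial.eval (fun j : σ => if j = t0 then (1 : ResidueField R) else 0)) h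
    simp only [F, map_add, map_mul, MvPolynomial.eval_X, MvPolynomial.eval_C, if_true, if_neg h01.symm, mul_zero,
      add_zero, mul_one, map_zero] at h'
    exact one_ne_zero h'
  · simp only [F, map_add, map_mul, MvPolynomial.rename_X, MvPolynomial.rename_C, coneε_X, coneε_C, t0, t1]
  · have hp : MvPolynomial.pderiv t0 F = 2 * MvPolynomial.X t0 + MvPolynomial.C (residue R b) * MvPolynomial.X t1 := by
      simp only [F, map_add, Derivation.leibniz, MvPolynomial.pderiv_X_self, MvPolynomial.pderiv_X_of_ne h01.symm,
        MvPolynomial.pderiv_C, smul_eq_mul, mul_one, mul_zero, add_zero]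
      ring
    show coneε c hz hd i (MvPolynomial.rename Subtype.val (MvPolynomial.pderiv t0 F)) = _
    rw [hp]
    simp only [map_add, map_mul, map_ofNat, MvPolynomial.rename_X, MvPolynomial.rename_C, coneε_X, coneε_C, t0, t1]
    ring
  · have hp : MvPolynomial.pderiv t1 F =
        MvPolynomial.C (residue R b) * MvPolynomial.X t0 + 2 * MvPolynomial.C (residue R a) * MvPolynomial.X t1 := by
      simp only [F, map_add, Derivation.leibniz, MvPolynomial.pderiv_X_self, MvPolynomial.pderiv_X_of_ne h01,
        MvPolynomial.pderiv_C, smul_eq_mul, mul_one, mul_zero, add_zero, zero_add]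
      ring
    show coneε c hz hd i (MvPolynomial.rename Subtype.val (MvPolynomial.pderiv t1 F)) = _
    rw [hp]
    simp only [map_add, map_mul, map_ofNat, MvPolynomial.rename_X, MvPolynomial.rename_C, coneε_X, coneε_C, t0, t1]
    ring

include hz hd h𝔓 in
/-- **Charts `2, 3` OFF the new line**: if not both `e₀, e₁ ∈ 𝔓`, the members of `{φ c_i, f_i}` in `𝔓`
(`f_i = e₀e₀ + b (e₀e₁) + a (e₁e₁)`) are part of one regular system of parameters of `L` (Jacobian criterion with
`∂F/∂T₀ = 2T₀ + b̄T₁` or `∂F/∂T₁ = b̄T₀ + 2āT₁`). [cite: Matsumura1987, Thm. 14.2, Thm. 30.3] -/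
theorem pointChart_far (hi0 : (0 : Fin 4) ≠ i) (hi1 : (1 : Fin 4) ≠ i) (hD : IsUnit (b * b - (a + a + (a + a))))
    (hnl : ¬ (chartGen c i 0 ∈ 𝔓 ∧ chartGen c i 1 ∈ 𝔓)) :
    ∃ (n : ℕ) (v : Fin n → L) (ι : {g : chartRing c i // g ∈ [chartBase c i (c i), fpt] ∧ g ∈ 𝔓} → Fin n),
      IsRsopPart v ∧ Function.Injective ι ∧ ∀ g, v (ι g) = (algebraMap (chartRing c i) L : chartRing c i →+* L) g.1 := by
  classical
  by_cases hf : fpt ∈ 𝔓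
  · obtain ⟨F, hF0, hfF, hG0, hG1⟩ := pointFar_repr c hz hd a b i hi0 hi1
    have hDφ : IsUnit (chartBase c i b * chartBase c i b -
        (chartBase c i a + chartBase c i a + (chartBase c i a + chartBase c i a))) := by
      have := hD.map (chartBase c i); simpa only [map_sub, map_mul, map_add] using this
    have hrs : IsRsopPart (consFamily c i L (chartBase c i) (killFamily i (chartGen c i) [] fpt)) := by
      rcases binary_partial_notMem 𝔓 (chartBase c i a) (chartBase c i b) (chartGen c i 0) (chartGen c i 1) hDφ hnl with
        h1 | h2
      · exact isRsopPart_pointKill c hz hd i 𝔓 h𝔓 L [] List.nodup_nil (by simp) _ hf F hF0 hfF _ _ hG0 h1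
      · exact isRsopPart_pointKill c hz hd i 𝔓 h𝔓 L [] List.nodup_nil (by simp) _ hf F hF0 hfF _ _ hG1 h2
    exact rsopAdapted_of_consFamily_killFamily c i 𝔓 L [] _ hrs _ (fun g hg _ => by
      simp only [List.mem_cons, List.not_mem_nil, or_false] at hg
      rcases hg with rfl | rfl
      · exact Or.inl rfl
      · exact Or.inr (Or.inr rfl))
  · have hrs := isRsopPart_chartFamily_cone c hz hd i 𝔓 h𝔓 L (a := 0) (fun k => k.elim0)
      (Function.injective_of_subsingleton _) (fun k => k.elim0)
    exact rsopAdapted_of_chartFamily c i 𝔓 L _ hrs _ (fun g hg hgP => by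
      simp only [List.mem_cons, List.not_mem_nil, or_false] at hg
      rcases hg with rfl | rfl
      · exact Or.inl rfl
      · exact absurd hgP hf)

include hz hd h𝔓 in
/-- **Charts `2, 3` ON the new line** (`e₀, e₁ ∈ 𝔓`; `𝔓` any prime over `𝔪`, e.g. the generic point of the new line):
`(φ c_i, e₀, e₁)` — the tree's `chartFamily` at the indices `0, 1` — is part of a regular system of parameters of `L`, with
`v₀ = φ c_i`, `v₁ = e₀`, `v₂ = e₁`. [cite: StacksProject, Tag 0BIQ] -/
theorem pointLine (hi0 : (0 : Fin 4) ≠ i) (hi1 : (1 : Fin 4) ≠ i) (h0 : chartGen c i 0 ∈ 𝔓) (h1 : chartGen c i 1 ∈ 𝔓) :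
    IsRsopPart (chartFamily c i (Fin.elim0 : Fin 0 → R) L (chartBase c i) (chartGen c i)
        (![⟨0, hi0⟩, ⟨1, hi1⟩] : Fin 2 → {j : Fin 4 // j ≠ i})) ∧
      chartFamily c i (Fin.elim0 : Fin 0 → R) L (chartBase c i) (chartGen c i)
          (![⟨0, hi0⟩, ⟨1, hi1⟩] : Fin 2 → {j : Fin 4 // j ≠ i}) 0 =
        (algebraMap (chartRing c i) L : chartRing c i →+* L) (chartBase c i (c i)) ∧
      chartFamily c i (Fin.elim0 : Fin 0 → R) L (chartBase c i) (chartGen c i)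
          (![⟨0, hi0⟩, ⟨1, hi1⟩] : Fin 2 → {j : Fin 4 // j ≠ i}) (Fin.succ (Fin.castAdd 0 0)) =
        (algebraMap (chartRing c i) L : chartRing c i →+* L) (chartGen c i 0) ∧
      chartFamily c i (Fin.elim0 : Fin 0 → R) L (chartBase c i) (chartGen c i)
          (![⟨0, hi0⟩, ⟨1, hi1⟩] : Fin 2 → {j : Fin 4 // j ≠ i}) (Fin.succ (Fin.castAdd 0 1)) =
        (algebraMap (chartRing c i) L : chartRing c i →+* L) (chartGen c i 1) := by
  have hjJ : Function.Injective (![⟨0, hi0⟩, ⟨1, hi1⟩] : Fin 2 → {j : Fin 4 // j ≠ i}) := by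
    intro k k' h
    fin_cases k <;> fin_cases k'
    · rfl
    · have h' : (0 : Fin 4) = 1 := congrArg Subtype.val h
      exact absurd h' (by decide)
    · have h' : (1 : Fin 4) = 0 := congrArg Subtype.val h
      exact absurd h' (by decide)
    · rfl
  have hJ : ∀ k : Fin 2, chartGen c i ((![⟨0, hi0⟩, ⟨1, hi1⟩] : Fin 2 → {j : Fin 4 // j ≠ i}) k).1 ∈ 𝔓 := by
    intro k; fin_cases k
    exacts [h0, h1]
  refine ⟨isRsopPart_chartFamily_cone c hz hd i 𝔓 h𝔓 L _ hjJ hJ, rfl, ?_, ?_⟩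
  · rw [chartFamily, Fin.cons_succ, Fin.append_left]; rfl
  · rw [chartFamily, Fin.cons_succ, Fin.append_left]; rfl

end PointChart

end ConeDepth

end Summit.ResolutionOfSingularities.ResolutionOfSingularities.Theorems

end
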